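import Literature.AlgebraicGeometry.Resolution.ResolutionOfSingularities
import Literature.AlgebraicGeometry.Resolution.QuasiExcellentSchemes
import HarnessLib
import HarnessLib.Audit
import HarnessLib.Audit.TribunalTags

/-!
# Strong-Hypothesis Library — summit `ResolutionOfSingularities` (D-0034, skeleton)

The REGISTRY of known strong hypotheses `H` (open statements with `H ⇒ P` landed or printed) and
of known EQUIVALENT REFORMULATIONS `E` (`E ↔ P` landed) for the single-problem summit
`ResolutionOfSingularities`. Every registered entry carries
`@[strong_hypothesis "ResolutionOfSingularities.ResolutionOfSingularities"]`; the kernel tribunal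
(`#h21_tribunal`, D-0033 T1 rule (a)) probes each registered `H` against a route crux `C` for
`H → C`. Bridges live summit-side in `Summits/ResolutionOfSingularities/StrongHypotheses.lean`.
SKELETON pass: one newly stated hypothesis here (Grothendieck's quasi-excellent form), one closure
of a summit-side parametrised conjecture stated and tagged in the summit file (resolution by one
blowing up), and a census of the rest.

## The problem

* `ResolutionOfSingularities : Prop := Literature.AlgebraicGeometry.Resolution.ResolutionOfSingularities`
  (`Summits/ResolutionOfSingularities/ResolutionOfSingularities/Statement.lean`) — WEAK
  (non-embedded) resolution in EVERY POSITIVE characteristic and ALL dimensions: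
  `∀ p, p.Prime → ResolutionInChar.{0} p`, where `ResolutionInChar p` says that every reduced
  separated scheme of finite type over a field of characteristic `p` admits a proper birational
  `π : X̃ → X` with `X̃` regular (`Scheme.HasResolution`). No isomorphism over `Reg X`, no
  projectivity, no normal crossings. Known: `p = 0` (Hironaka 1964, named fact `Hironaka1964`),
  `dim ≤ 3` (Cossart–Piltant 2019, `CossartPiltant2019`, discharged in tree).

## Census (relation legend: "strictly stronger" = `H ⇒ P` known, `P ⇒ H` not known in print;
"equivalent" = `H ↔ P` landed; "weaker" = `P ⇒ H` landed; "partial" = a sub-case of `P`)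

| # | `H` / `E` | one-line statement | relation | source | status here | bridge |
|---|---|---|---|---|---|---|
| 1 | `QuasiExcellentResolution` | every reduced separated Noetherian QUASI-EXCELLENT scheme (any characteristic, mixed included, any dimension) admits a resolution | strictly stronger (Grothendieck's problem; contains the summit since finite type over a field ⇒ excellent, Stacks 07QW, discharged in tree) | EGA IV₂ (7.9.6); Cossart–Piltant 2019 Thm. 1.1 is exactly this for `dim ≤ 3`; Temkin 2008 for `ℚ`-schemes | NEW (stated here), registered | landed: `Summit.ResolutionOfSingularities.StrongHypotheses.quasiExcellentResolution_implies_resolutionOfSingularities` |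
| 2 | `Summit.ResolutionOfSingularities.StrongHypotheses.BlowupResolution` (closure `∀ p prime` of `Summit.….BlowupResolutionInChar p`) | every integral separated scheme of finite type over a field of characteristic `p > 0` has a non-zero ideal sheaf whose blowing up is regular (resolution by ONE blowing up = projective resolution, Hironaka's format) | strictly stronger (formally: a regular blowing up is a resolution; converse not formal) | Hironaka 1964 Main Thm. I (format); Cossart–Jannsen–Saito 2020 Thm. 1.2 (dim ≤ 2); Piltant 2013 p. 2 (open in dim ≥ 4) | NEW closure, stated and registered IN THE SUMMIT FILE (the parametrised conjecture lives in a `Summits` module) | landed: `Summit.ResolutionOfSingularities.StrongHypotheses.blowupResolution_implies_resolutionOfSingularities` (over `Theorems.resolutionInChar_of_blowupResolutionInChar`) |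
| 3 | integral resolution `∀ p prime, IntegralResolutionInChar.{0} p` | resolution for INTEGRAL separated schemes of finite type in every prime characteristic | equivalent (landed `Literature.AlgebraicGeometry.Resolution.resolutionOfSingularities_iff_integral`: resolve components and glue) | Cossart–Piltant 2019, proof of Prop. 4.6 Step 1 | existing PARAMETRISED predicate `IntegralResolutionInChar (p : ℕ)` (`ResolutionOfComponents.lean`); closure not spent (budget) | landed `↔` exists for the closure — follow-up |
| 4 | strong resolution by one Sing-admissible blowing up, `∀ p prime, Summit.….StrongBlowupResolutionInChar p` | as row 2 with cosupport of the ideal inside `Sing X` (isomorphism over `Reg X`) | strictly stronger (⇒ row 2) | CJS 2020 Thm. 1.2 (format); Piltant 2013 | existing parametrised summit-side conjecture; closure not spent | landed for each `p`: `Theorems.resolutionInChar_of_strongBlowupResolutionInChar` |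
| 5 | embedded resolution in codimension `≥ 2`, CJS format, `∀ p prime, Summit.….Theorems.EmbResCodimTwo p` | Piltant's Axiom 3 in all transcendence degrees | strictly stronger | Piltant 2013 §2 Axiom 3; CJS 2020 | existing parametrised summit-side conjecture; closure not spent | landed: `Theorems.resolutionOfSingularities_of_embResCodimTwo` (takes the `∀ p prime` closure as hypothesis) |
| 6 | principalization on regular varieties in blow-up format, `Summit.….PrincipalizationInChar p` | Piltant's Axiom 4 / Kollár's principalization in char `p` | stronger in Kollár's char-0 architecture (principalization ⇒ resolution, Kollár 2007 Ch. 3); in tree only `→ RegularBlowupExcAdmissibleResolution p` is landed | Kollár 2007 Thm. 3.35 ⇒ 3.36 (char 0 mechanism); Piltant 2013 §2 | existing parametrised summit-side conjecture, not registered | none in tree (printed mechanism is char-0; in char `p` it feeds Zariski patching together with LU) |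
| 7 | Hironaka-style order reduction / maximal contact in char `p` | existence of hypersurfaces of maximal contact (or a substitute invariant that drops under permissible blow-ups) in positive characteristic | strictly stronger as a PROGRAMME; FALSE as literally stated (Narasimhan's example: no maximal contact in char `p`, barrier `Literature.Barriers.ResolutionOfSingularities.NarasimhanMaximalContact`; kangaroo points, `KangarooShadeIncrease`) | Hironaka 1964; Hauser 2010 | not typeable as ONE honest closed `Prop` (the true statement is "some invariant works", a second-order existence over resolution algorithms) | none |
| 8 | regular `p`-alterations / degree-`1` alterations | de Jong alterations of degree prime to … / Gabber–Temkin `p`-alterations improved to degree `1` | "degree-1 alteration with regular source" IS a resolution (equivalent by definition); Temkin 2017 `char(X)`-alterations are theorems, not hypotheses | de Jong 1996 Thm. 4.1 (`DeJong1996`, named fact); Temkin 2017 Thm. 1.2.5; Gabber (Illusie–Temkin 2014) | the route `Theses/PAlteration` carries `PIAlt_p ∧ PICover_p ↔ ResolutionInChar p` (landed, `Theorems/PAlterationPalterationThesisIffSummit`) — ROUTE decls, never tagged | — |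

## Deliberately NOT registered (and why)

* WEAKER than the summit (landed `P ⇒ H`), hence useless as strong hypotheses:
  - local uniformization `Literature.AlgebraicGeometry.Resolution.LocalUniformizationInChar p`
    (Zariski 1940; open for `p > 0`, `trdeg ≥ 4`): `ResolutionInChar p → LocalUniformizationInChar p`
    (`ResolutionLU.lean`). LU implies resolution only WITH a patching input (Zariski 1944 /
    Piltant 2013 Prop. 5.1: rows 4–6 territory; in tree the cruxes `PatchingRel`, `SandwichedLocusResolution p`);
  - the Abramovich–Oort / Temkin conjecture `Literature.AlgebraicGeometry.Resolution.AbramovichOortConjecture`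
    (regular PURELY INSEPARABLE alterations; AO 2000 Q. 2.13, Temkin 2013 Conj. 1.3.1):
    `ResolutionInChar p →` it (`AlterationsResolution.lean`); the converse is de Jong-type descent,
    open (route `PAlteration`);
  - `SandwichedSingularitiesResolution p`, `SandwichedLocusResolution p` (+ `DimLe/DimGt` slices),
    `SandwichedWeakResolution p`, `RegModel p`, `TwoModelPatching p`, `RegLeification p`: special
    cases / patching inputs implied by `ResolutionInChar p` (their files say so), i.e. PARTIAL.
* THEOREMS, not hypotheses: `Hironaka1964`, `CossartPiltant2019(General)`, `CossartJannsenSaito2020*`,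
  `DeJong1996*`, `Temkin2008`, `Temkin2013_*`, `KnafKuhlmann2009*`, Abhyankar's theorems
  (`Abhyankar*.lean`), `BerghRydh2019_*`, `IllusieTemkin`/`Kato1994_logRegular*` (log-regular case).
* The semistable reduction conjecture (over a DVR / in families): RELATED (implied by
  functorial embedded resolution in char 0 via KKMS; in char `p` neither direction to the summit
  is in print); no closed `Prop` in tree. Not registered.
* Multi-`p` slices ("resolution in characteristic `p₀`" for one prime, `ResolutionInChar p₀`;
  "dimension `≤ 4`", `IntegralResolutionOverUpToDim k 4`): PARTIAL. Not registered.

## Not yet typeable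

* Row 7 (maximal contact / order-reduction hypotheses in char `p`): the honest content is a
  statement about the EXISTENCE OF AN INVARIANT governing a blow-up algorithm; every literal
  first-order rendering known to us is either refuted (Narasimhan, kangaroo phenomena — both
  vendored as barriers) or is row 2/4 again.
* Functorial / canonical resolution in char `p` (BM–Włodarczyk style, functorial for smooth
  morphisms): typeable in principle (`CanonicalResolution.lean` has the char-0 named fact
  `BierstoneGrigorievMilmanWlodarczyk2011_canonical`), but the functoriality clause needs the
  category of blow-up sequences (`KollarBlowupSequenceFunctors.lean`) wired to `ResolutionInChar`;
  > 15 lines, left as a candidate. It is strictly stronger (⇒ row 4 ⇒ row 2 ⇒ summit).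

## Sources (keys in `lean/references.bib`)

[EGAIV2] §7.9, (7.9.5)–(7.9.6); [Kollar2007] Ch. 3, Thms. 3.35–3.36; [Hironaka1964] Main Thm. I;
[CossartPiltant2019] Thm. 1.1, Prop. 4.4, proof of Prop. 4.6; [CossartJannsenSaito2020] Thm. 1.2;
[Temkin2008]; [Piltant2013] §2 (Axioms 3–4), Prop. 5.1, Cor. 5.7, p. 2; [Zariski1940]; [Zariski1944];
[AbramovichOort2000] Q. 2.13; [Temkin2013] Conj. 1.3.1, Thm. 1.3.2; [Temkin2017] Thm. 1.2.5;
[DeJong1996] Thm. 4.1; [Hauser2010]; [StacksProject] Tags 07QW, 07PV, 02IS, 01RN.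

## Design notes

* Row 1 copies the printed hypotheses of Cossart–Piltant 2019 Thm. 1.1 (reduced, separated,
  Noetherian, quasi-excellent — the tree's `CossartPiltant2019General`) with the dimension bound
  REMOVED and the weak conclusion `Scheme.HasResolution` of the summit; universe fixed to `0` like
  the summit conjunct (a `Prop` without universe parameters). Grothendieck (EGA IV₂ 7.9.5) proved
  quasi-excellence NECESSARY for resolution of all finite `X`-schemes (barrier
  `Literature.Barriers.ResolutionOfSingularities.QuasiExcellenceNecessary`), and (7.9.6) poses the
  sufficiency; the statement covers mixed characteristic and so is genuinely wider than the summit.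
-/

noncomputable section

open CategoryTheory AlgebraicGeometry

namespace Literature.StrongHypotheses.ResolutionOfSingularities

open Literature.AlgebraicGeometry.Resolution

/-! ## Strictly stronger, newly stated -/

/-- OPEN CONJECTURE — **resolution of singularities of quasi-excellent schemes (Grothendieck's
problem)**: every reduced, separated, Noetherian, quasi-excellent scheme `X` admits a resolution of
singularities — a proper birational `π : X' → X` with `X'` regular (`Scheme.HasResolution`). Posed
in EGA IV₂ (7.9.6) after Grothendieck's proof (7.9.5) that quasi-excellence is necessary for the
resolution of all integral finite `X`-schemes; it is the generality in which the low-dimensional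
theorems are printed (Cossart–Piltant 2019, Thm. 1.1: exactly this statement for `dim X ≤ 3`, in
tree `CossartPiltant2019General`; Cossart–Jannsen–Saito 2020, Thm. 1.2, `dim ≤ 2`; Temkin 2008
for Noetherian quasi-excellent `ℚ`-schemes). STRICTLY STRONGER than the summit: a reduced
separated scheme of finite type over a field is Noetherian, separated and excellent (Stacks 07QW,
in tree `Stacks07QW_field_holds` with `Scheme.isQuasiExcellent_of_locallyOfFiniteType`), so the
summit is the equal-characteristic finite-type slice (bridge LANDED, summit file); the statement
also covers mixed characteristic and non-finite-type excellent schemes. Open in every generality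
beyond `dim ≤ 3`. Universe fixed to `0` as for the summit conjunct.
[cite: EGAIV2, (7.9.6) with (7.9.5)] [status: open] -/
@[conjecture, strong_hypothesis "ResolutionOfSingularities.ResolutionOfSingularities"]
def QuasiExcellentResolution : Prop :=
  ∀ (X : Scheme.{0}) [X.IsSeparated] [IsNoetherian X] [IsReduced X],
    Scheme.IsQuasiExcellent X → Scheme.HasResolution X

end Literature.StrongHypotheses.ResolutionOfSingularities
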